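import Mathlib
import HarnessLib
import Summits.ValiantsHypothesis.ValiantsHypothesis.Theorems.LacunarySymmetroidMatrixDescartesProductPlusOneBalanceCount

/-!
# ValiantsHypothesis / LacunarySymmetroid — crux `MatrixDescartes` (stmt-ValiantsHypothesis-18050, V1),
# LINE (A) «product_plus_one», floor `OneChangeFloorK3`: the EXACT balance zone `B_j(x^{q−p}) < 0` (every support ratio)

Refinement of ✓ `…BalanceZone` / ✓ `…BalanceCount`.  For a no-dip row `g = a + b x^p + c x^q` (`a c < 0`; `p = e+1`, `q = e+k+2`) the
numerator of `Ψ_j′` is `a c·q(q−p)x^{q−p−1} − x^{p−1}·B(Z)`, `Z = x^{q−p}`, with the BALANCE FORM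

  `B(Z) = pq·c²·Z² − q(q−3p)·bc·Z + p²·b²`

(✓ `key_identity`: `4p·B(Z) = q(2pcZ − (q−3p)b)² + (q−p)²(4p−q)b²`, so `B ≥ 0` identically iff ratio `≤ 4`).  Hence (`numerator_neg_of_balance`)
the row is `Ψ`-decreasing in EVERY phase wherever `B(x^{q−p}) ≥ 0`; top-domination (`(q−3p)bc ≤ p c² Z`) and middle-domination
(`q(q−3p)bc Z ≤ p²b²`) of ✓ `…BalanceZone` are the two obvious halves of this condition.  The EXACT balance zone of an incoherent row is the
root interval `(Z₋, Z₊)` of `B` — in units of `|b|/|c|`, `Z± = [r(r−3) ± (r−1)√(r(r−4))]/(2pr)`, `r = q/p` — which closes up to the point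
`Z = |b|/(8|c|)·…` as `r ↓ 4` (continuity with the tame sector), whereas the dominance bounds give `(p²/(q(q−3p)), (q−3p)/p)`.

* `numerator_neg_of_balance`, `numerator_neg_of_row''` (criterion: opposite the top letter ∨ no-dip with `B(x^{q−p}) ≥ 0`; subsumes tame,
  coherent, dominated), `hasDerivAt_psi_neg_of_rows''`, `psi_injective_of_rows''`, `X_mul_derivative_no_two_zeros_of_rows''`;
* ★ `euler_window_roots_le_one_of_balance` — window law: on a zero-free window where at every point every row is opposite its top letter or
  has `B_j ≥ 0`, `eulerNumerator d a 0` has at most ONE root (ANY support);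
* `balance_mono_beyond_vertex` — beyond its vertex (`2p·c²·Z ≥ q… ` i.e. `2p c² Z ≥ (q−3p) bc`) `B` is non-decreasing in `Z`, so
  ★ `euler_roots_beyond_exactZone_le`: no-dip company, `U > 0` with every row beyond its vertex and `B_j(U^{q−p}) ≥ 0` ⇒ at most `2m + 1` roots
  of `eulerNumerator d a 0` in `[U, ∞)` — whatever the phases.

HONEST FRAMING: a refinement cell of the research floor; NOT `OneChangeFloorK3` / the stubs / `MatrixDescartes`; `VP ≠ VNP` is NOT proved.
No definitions, no named facts; Mathlib + the lane files.
-/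

set_option linter.dupNamespace false

namespace Summit.ValiantsHypothesis.ValiantsHypothesis.Theorems.LacunarySymmetroidMatrixDescartes

namespace ProductPlusOne

open Polynomial Finset
open scoped BigOperators

/-! ### §1 The balance form -/

/-- **No-dip row with non-negative balance form is `Ψ`-decreasing** (every phase, every ratio): `a c < 0`, `x > 0`,
`pq·c²·Z² − q(q−3p)·bc·Z + p²·b² ≥ 0` at `Z = x^{k+1}` ⇒ `num < 0`. [this file's lemma] -/
theorem numerator_neg_of_balance (a b c : ℝ) (e k : ℕ) (hac : a * c < 0) {x : ℝ} (hx : 0 < x)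
    (hB : 0 ≤ (e + 1 : ℝ) * (e + k + 2 : ℝ) * c ^ 2 * (x ^ (k + 1)) ^ 2
      - (e + k + 2 : ℝ) * ((e + k + 2 : ℝ) - 3 * (e + 1 : ℝ)) * (b * c) * x ^ (k + 1) + (e + 1 : ℝ) ^ 2 * b ^ 2) :
    ((e + k + 2 : ℝ) * c * ((k + 1 : ℝ) * x ^ k)) * (a + b * x ^ (e + 1) + c * x ^ (e + k + 2))
        - ((e + 1 : ℝ) * b + (e + k + 2 : ℝ) * c * x ^ (k + 1))
          * (b * ((e + 1 : ℝ) * x ^ e) + c * ((e + k + 2 : ℝ) * x ^ (e + k + 1))) < 0 := by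
  have hid : ((e + k + 2 : ℝ) * c * ((k + 1 : ℝ) * x ^ k)) * (a + b * x ^ (e + 1) + c * x ^ (e + k + 2))
      - ((e + 1 : ℝ) * b + (e + k + 2 : ℝ) * c * x ^ (k + 1))
        * (b * ((e + 1 : ℝ) * x ^ e) + c * ((e + k + 2 : ℝ) * x ^ (e + k + 1)))
      = a * c * ((e + k + 2 : ℝ) * (k + 1 : ℝ)) * x ^ k
        - x ^ e * ((e + 1 : ℝ) * (e + k + 2 : ℝ) * c ^ 2 * (x ^ (k + 1)) ^ 2
          - (e + k + 2 : ℝ) * ((e + k + 2 : ℝ) - 3 * (e + 1 : ℝ)) * (b * c) * x ^ (k + 1) + (e + 1 : ℝ) ^ 2 * b ^ 2) := by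
    ring
  rw [hid]
  have h1 : a * c * ((e + k + 2 : ℝ) * (k + 1 : ℝ)) * x ^ k < 0 :=
    mul_neg_of_neg_of_pos (mul_neg_of_neg_of_pos hac (by positivity)) (pow_pos hx k)
  have h2 : 0 ≤ x ^ e * ((e + 1 : ℝ) * (e + k + 2 : ℝ) * c ^ 2 * (x ^ (k + 1)) ^ 2
      - (e + k + 2 : ℝ) * ((e + k + 2 : ℝ) - 3 * (e + 1 : ℝ)) * (b * c) * x ^ (k + 1) + (e + 1 : ℝ) ^ 2 * b ^ 2) :=
    mul_nonneg (pow_pos hx e).le hB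
  linarith

/-- The balance form is non-negative for TAME supports (`k ≤ 3e+2`, ratio `≤ 4`; ✓ `key_quadratic_nonpos`), for COHERENT rows at ratio `≥ 3`
(`bc ≤ 0`), and for DOMINATED rows — so the balance criterion subsumes those of ✓ `…BalanceZone`. [this file's lemma] -/
theorem balance_nonneg_of_dominated (b c : ℝ) (e k : ℕ) {x : ℝ} (hx : 0 < x)
    (h : k ≤ 3 * e + 2 ∨
      ((e + k + 2 : ℝ) - 3 * (e + 1 : ℝ)) * (b * c) ≤ (e + 1 : ℝ) * c ^ 2 * x ^ (k + 1) ∨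
      (e + k + 2 : ℝ) * ((e + k + 2 : ℝ) - 3 * (e + 1 : ℝ)) * (b * c) * x ^ (k + 1) ≤ (e + 1 : ℝ) ^ 2 * b ^ 2) :
    0 ≤ (e + 1 : ℝ) * (e + k + 2 : ℝ) * c ^ 2 * (x ^ (k + 1)) ^ 2
      - (e + k + 2 : ℝ) * ((e + k + 2 : ℝ) - 3 * (e + 1 : ℝ)) * (b * c) * x ^ (k + 1) + (e + 1 : ℝ) ^ 2 * b ^ 2 := by
  have hZ : 0 ≤ x ^ (k + 1) := (pow_pos hx _).le
  have hb2 : 0 ≤ (e + 1 : ℝ) ^ 2 * b ^ 2 := by positivity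
  have hc2 : 0 ≤ (e + 1 : ℝ) * (e + k + 2 : ℝ) * c ^ 2 * (x ^ (k + 1)) ^ 2 := by positivity
  rcases h with hk | h | h
  · have hQ := key_quadratic_nonpos (p := (e + 1 : ℝ)) (q := (e + k + 2 : ℝ)) (by positivity) (by positivity)
      (by have : (k : ℝ) ≤ 3 * e + 2 := by exact_mod_cast hk
          linarith) b c (x ^ (k + 1))
    linarith
  · have h' : (e + k + 2 : ℝ) * x ^ (k + 1) * (((e + k + 2 : ℝ) - 3 * (e + 1 : ℝ)) * (b * c))
        ≤ (e + k + 2 : ℝ) * x ^ (k + 1) * ((e + 1 : ℝ) * c ^ 2 * x ^ (k + 1)) :=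
      mul_le_mul_of_nonneg_left h (mul_nonneg (by positivity) hZ)
    have e1 : (e + k + 2 : ℝ) * ((e + k + 2 : ℝ) - 3 * (e + 1 : ℝ)) * (b * c) * x ^ (k + 1)
        = (e + k + 2 : ℝ) * x ^ (k + 1) * (((e + k + 2 : ℝ) - 3 * (e + 1 : ℝ)) * (b * c)) := by ring
    have e2 : (e + 1 : ℝ) * (e + k + 2 : ℝ) * c ^ 2 * (x ^ (k + 1)) ^ 2
        = (e + k + 2 : ℝ) * x ^ (k + 1) * ((e + 1 : ℝ) * c ^ 2 * x ^ (k + 1)) := by ring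
    rw [e1, e2]
    linarith
  · linarith

/-- **The balance criterion per row:** opposite the top letter (`c·g(x) < 0`), or no-dip (`a c < 0`) with `B(x^{k+1}) ≥ 0`. [this file's lemma] -/
theorem numerator_neg_of_row'' (a b c : ℝ) (e k : ℕ) {x : ℝ} (hx : 0 < x)
    (hrow : c * (a + b * x ^ (e + 1) + c * x ^ (e + k + 2)) < 0 ∨
      (a * c < 0 ∧ 0 ≤ (e + 1 : ℝ) * (e + k + 2 : ℝ) * c ^ 2 * (x ^ (k + 1)) ^ 2
        - (e + k + 2 : ℝ) * ((e + k + 2 : ℝ) - 3 * (e + 1 : ℝ)) * (b * c) * x ^ (k + 1) + (e + 1 : ℝ) ^ 2 * b ^ 2)) :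
    ((e + k + 2 : ℝ) * c * ((k + 1 : ℝ) * x ^ k)) * (a + b * x ^ (e + 1) + c * x ^ (e + k + 2))
        - ((e + 1 : ℝ) * b + (e + k + 2 : ℝ) * c * x ^ (k + 1))
          * (b * ((e + 1 : ℝ) * x ^ e) + c * ((e + k + 2 : ℝ) * x ^ (e + k + 1))) < 0 := by
  rcases hrow with h | ⟨hac, hB⟩
  · exact numerator_neg_of_unswitched a b c e k hx h
  · exact numerator_neg_of_balance a b c e k hac hx hB

/-! ### §2 `Ψ′ < 0`, Rolle, window law under the balance criterion -/

/-- **`Ψ′ < 0` under the balance criterion** (`m ≥ 1`, `x > 0`, no factor vanishing). [this file's theorem] -/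
theorem hasDerivAt_psi_neg_of_rows'' {m : ℕ} (hm : 0 < m) (a b c : Fin m → ℝ) (e k : ℕ) {x : ℝ} (hx : 0 < x)
    (hg : ∀ j, a j + b j * x ^ (e + 1) + c j * x ^ (e + k + 2) ≠ 0)
    (hrow : ∀ j, c j * (a j + b j * x ^ (e + 1) + c j * x ^ (e + k + 2)) < 0 ∨
      (a j * c j < 0 ∧ 0 ≤ (e + 1 : ℝ) * (e + k + 2 : ℝ) * c j ^ 2 * (x ^ (k + 1)) ^ 2
        - (e + k + 2 : ℝ) * ((e + k + 2 : ℝ) - 3 * (e + 1 : ℝ)) * (b j * c j) * x ^ (k + 1) + (e + 1 : ℝ) ^ 2 * b j ^ 2)) :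
    ∃ D : ℝ, D < 0 ∧ HasDerivAt (fun y : ℝ => ∑ j, ((e + 1 : ℝ) * b j + (e + k + 2 : ℝ) * c j * y ^ (k + 1))
        / (a j + b j * y ^ (e + 1) + c j * y ^ (e + k + 2))) D x := by
  refine ⟨∑ j, ((((e + k + 2 : ℝ) * c j * ((k + 1 : ℝ) * x ^ k)) * (a j + b j * x ^ (e + 1) + c j * x ^ (e + k + 2))
        - ((e + 1 : ℝ) * b j + (e + k + 2 : ℝ) * c j * x ^ (k + 1))
          * (b j * ((e + 1 : ℝ) * x ^ e) + c j * ((e + k + 2 : ℝ) * x ^ (e + k + 1))))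
        / (a j + b j * x ^ (e + 1) + c j * x ^ (e + k + 2)) ^ 2), ?_, ?_⟩
  · refine Finset.sum_neg (fun j _ => ?_) ⟨⟨0, hm⟩, Finset.mem_univ _⟩
    exact div_neg_of_neg_of_pos (numerator_neg_of_row'' (a j) (b j) (c j) e k hx (hrow j)) (by have h0 := hg j; positivity)
  · exact HasDerivAt.fun_sum (u := Finset.univ) (fun j _ => hasDerivAt_term (a j) (b j) (c j) e k (hg j))

/-- **Window law, normalised chart, balance criterion:** no two zeros of `X·P′` in a zero-free window where every factor meets the balance
criterion pointwise. [this file's theorem] -/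
theorem X_mul_derivative_no_two_zeros_of_rows'' {m : ℕ} (hm : 0 < m) (a b c : Fin m → ℝ) (e k : ℕ) {w₁ w₂ : ℝ}
    (hw₁ : 0 < w₁) (hw : w₁ < w₂)
    (hfree : ∀ t ∈ Set.Icc w₁ w₂, ∀ j, a j + b j * t ^ (e + 1) + c j * t ^ (e + k + 2) ≠ 0)
    (hrow : ∀ t ∈ Set.Icc w₁ w₂, ∀ j, c j * (a j + b j * t ^ (e + 1) + c j * t ^ (e + k + 2)) < 0 ∨
      (a j * c j < 0 ∧ 0 ≤ (e + 1 : ℝ) * (e + k + 2 : ℝ) * c j ^ 2 * (t ^ (k + 1)) ^ 2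
        - (e + k + 2 : ℝ) * ((e + k + 2 : ℝ) - 3 * (e + 1 : ℝ)) * (b j * c j) * t ^ (k + 1) + (e + 1 : ℝ) ^ 2 * b j ^ 2))
    (h1 : eval w₁ (X * derivative (∏ j, (C (a j) + C (b j) * X ^ (e + 1) + C (c j) * X ^ (e + k + 2)))) = 0)
    (h2 : eval w₂ (X * derivative (∏ j, (C (a j) + C (b j) * X ^ (e + 1) + C (c j) * X ^ (e + k + 2)))) = 0) : False := by
  have hcont : ContinuousOn (fun y : ℝ => ∑ j, ((e + 1 : ℝ) * b j + (e + k + 2 : ℝ) * c j * y ^ (k + 1))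
      / (a j + b j * y ^ (e + 1) + c j * y ^ (e + k + 2))) (Set.Icc w₁ w₂) := by
    intro t ht
    obtain ⟨D, _, hD⟩ := hasDerivAt_psi_neg_of_rows'' hm a b c e k (hw₁.trans_le ht.1) (hfree t ht) (hrow t ht)
    exact hD.continuousAt.continuousWithinAt
  have heq := (psi_eq_zero_of_eval_X_mul_derivative a b c e k hw₁ (hfree w₁ ⟨le_rfl, hw.le⟩) h1).trans
    (psi_eq_zero_of_eval_X_mul_derivative a b c e k (hw₁.trans hw) (hfree w₂ ⟨hw.le, le_rfl⟩) h2).symm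
  obtain ⟨ξ, hξ, hξ'⟩ := exists_deriv_eq_zero hw hcont heq
  obtain ⟨D, hDneg, hD⟩ := hasDerivAt_psi_neg_of_rows'' hm a b c e k (hw₁.trans hξ.1)
    (hfree ξ ⟨hξ.1.le, hξ.2.le⟩) (hrow ξ ⟨hξ.1.le, hξ.2.le⟩)
  rw [hD.deriv] at hξ'
  exact hDneg.ne hξ'

/-- ★ **THE WINDOW LAW WITH THE EXACT BALANCE CLAUSE** (`K = 3`, bottom coupling, ANY support `d 0 < d 1 < d 2`, any `m`): on a zero-free
window `[u,v] ⊂ (0,∞)` on which at every point `t` every row is opposite its top letter (`a_{j2}·f_j(t) < 0`) OR a no-dip row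
(`a_{j0} a_{j2} < 0`) with non-negative balance form
`pq·a_{j2}²·t^{2(d₂−d₁)} − q(q−3p)·a_{j1}a_{j2}·t^{d₂−d₁} + p²·a_{j1}² ≥ 0` (`p = d₁−d₀`, `q = d₂−d₀`), `eulerNumerator d a 0` (unfolded) has AT MOST
ONE root. [this file's theorem] -/
theorem euler_window_roots_le_one_of_balance {m : ℕ} (d : Fin 3 → ℕ) (h01 : d 0 < d 1) (h12 : d 1 < d 2)
    (a : Fin m → Fin 3 → ℝ) {u v : ℝ} (hu : 0 < u)
    (hfree : ∀ t ∈ Set.Icc u v, ∀ j, (∑ l, C (a j l) * X ^ (d l) : ℝ[X]).eval t ≠ 0)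
    (hrow : ∀ t ∈ Set.Icc u v, ∀ j,
      a j 2 * (∑ l, C (a j l) * X ^ (d l) : ℝ[X]).eval t < 0 ∨
      (a j 0 * a j 2 < 0 ∧ 0 ≤ ((d 1 : ℝ) - d 0) * ((d 2 : ℝ) - d 0) * a j 2 ^ 2 * (t ^ (d 2 - d 1)) ^ 2
        - ((d 2 : ℝ) - d 0) * (((d 2 : ℝ) - d 0) - 3 * ((d 1 : ℝ) - d 0)) * (a j 1 * a j 2) * t ^ (d 2 - d 1)
        + ((d 1 : ℝ) - d 0) ^ 2 * a j 1 ^ 2)) :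
    ((∑ j, (∑ l, C (a j l * ((d l : ℝ) - d 0)) * X ^ (d l)) * ∏ i ∈ Finset.univ.erase j, (∑ l, C (a i l) * X ^ (d l))
        : ℝ[X]).roots.toFinset.filter (fun t => u ≤ t ∧ t ≤ v)).card ≤ 1 := by
  classical
  rcases Nat.eq_zero_or_pos m with hm | hm
  · subst hm
    simp only [Finset.univ_eq_empty, Finset.sum_empty, roots_zero, Multiset.toFinset_zero, Finset.filter_empty,
      Finset.card_empty]
    exact Nat.zero_le _
  obtain ⟨e, he⟩ : ∃ e, d 1 = d 0 + e + 1 := ⟨d 1 - d 0 - 1, by omega⟩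
  obtain ⟨k, hk⟩ : ∃ k, d 2 = d 0 + e + k + 2 := ⟨d 2 - d 1 - 1, by omega⟩
  have hk1 : d 2 - d 1 = k + 1 := by omega
  have hp : ((d 1 : ℝ) - d 0) = (e + 1 : ℝ) := by rw [he]; push_cast; ring
  have hq : ((d 2 : ℝ) - d 0) = (e + k + 2 : ℝ) := by rw [hk]; push_cast; ring
  rw [eulerNumerator_eq d e k he hk a 0, sub_self, mul_zero, map_zero, zero_mul, sub_zero]
  set E : ℝ[X] := X * derivative (∏ j, (C (a j 0) + C (a j 1) * X ^ (e + 1) + C (a j 2) * X ^ (e + k + 2))) with hE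
  by_contra hgt
  push Not at hgt
  obtain ⟨z₁, hz₁, z₂, hz₂, hne⟩ := Finset.one_lt_card.mp hgt
  have hfree' : ∀ w₁ w₂ : ℝ, u ≤ w₁ → w₂ ≤ v → ∀ t ∈ Set.Icc w₁ w₂, ∀ j,
      a j 0 + a j 1 * t ^ (e + 1) + a j 2 * t ^ (e + k + 2) ≠ 0 := by
    intro w₁ w₂ hw₁ hw₂ t ht j
    have h := hfree t ⟨hw₁.trans ht.1, ht.2.trans hw₂⟩ j
    rw [eval_row_eq_pow_mul d e k he hk (a j) t] at h
    exact right_ne_zero_of_mul h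
  have hrow' : ∀ w₁ w₂ : ℝ, u ≤ w₁ → w₂ ≤ v → ∀ t ∈ Set.Icc w₁ w₂, ∀ j,
      a j 2 * (a j 0 + a j 1 * t ^ (e + 1) + a j 2 * t ^ (e + k + 2)) < 0 ∨
      (a j 0 * a j 2 < 0 ∧ 0 ≤ (e + 1 : ℝ) * (e + k + 2 : ℝ) * a j 2 ^ 2 * (t ^ (k + 1)) ^ 2
        - (e + k + 2 : ℝ) * ((e + k + 2 : ℝ) - 3 * (e + 1 : ℝ)) * (a j 1 * a j 2) * t ^ (k + 1) + (e + 1 : ℝ) ^ 2 * a j 1 ^ 2) := by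
    intro w₁ w₂ hw₁ hw₂ t ht j
    have htI : t ∈ Set.Icc u v := ⟨hw₁.trans ht.1, ht.2.trans hw₂⟩
    have ht0 : 0 < t := hu.trans_le htI.1
    have htd : 0 < t ^ (d 0) := pow_pos ht0 _
    rcases hrow t htI j with h | ⟨hac, hB⟩
    · left
      rw [eval_row_eq_pow_mul d e k he hk (a j) t, mul_left_comm] at h
      exact neg_of_mul_neg_right h htd.le
    · right
      refine ⟨hac, ?_⟩
      rw [hp, hq, hk1] at hB
      exact hB
  have hmem : ∀ z ∈ (((X : ℝ[X]) ^ (m * d 0) * E).roots.toFinset.filter (fun t => u ≤ t ∧ t ≤ v)),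
      u ≤ z ∧ z ≤ v ∧ eval z E = 0 := by
    intro z hz
    rw [mem_filter, Multiset.mem_toFinset] at hz
    by_cases h0 : (X : ℝ[X]) ^ (m * d 0) * E = 0
    · rw [h0, roots_zero] at hz
      exact absurd hz.1 (Multiset.notMem_zero _)
    · have hr := (mem_roots h0).mp hz.1
      rw [IsRoot.def, eval_mul, eval_pow, eval_X] at hr
      refine ⟨hz.2.1, hz.2.2, ?_⟩
      rcases mul_eq_zero.mp hr with h | h
      · exact absurd h (pow_ne_zero _ (hu.trans_le hz.2.1).ne')
      · exact h
  obtain ⟨hu₁, hv₁, hE₁⟩ := hmem z₁ hz₁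
  obtain ⟨hu₂, hv₂, hE₂⟩ := hmem z₂ hz₂
  rcases lt_or_gt_of_ne hne with hlt | hlt
  · exact X_mul_derivative_no_two_zeros_of_rows'' hm (fun j => a j 0) (fun j => a j 1) (fun j => a j 2) e k
      (hu.trans_le hu₁) hlt (hfree' z₁ z₂ hu₁ hv₂) (hrow' z₁ z₂ hu₁ hv₂) hE₁ hE₂
  · exact X_mul_derivative_no_two_zeros_of_rows'' hm (fun j => a j 0) (fun j => a j 1) (fun j => a j 2) e k
      (hu.trans_le hu₂) hlt (hfree' z₂ z₁ hu₂ hv₁) (hrow' z₂ z₁ hu₂ hv₁) hE₂ hE₁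

/-! ### §3 Beyond the exact zone: monotonicity of `B` past its vertex and the half-line count -/

/-- **Past its vertex the balance form is non-decreasing in `Z`:** if `2·pq c²·Z₁ ≥ q(q−3p)·bc` (vertex) and `Z₁ ≤ Z₂` then
`B(Z₁) ≤ B(Z₂)` (convex parabola). [folklore] -/
theorem balance_mono_beyond_vertex (α β γ : ℝ) (hα : 0 ≤ α) {Z₁ Z₂ : ℝ} (hv : β ≤ 2 * α * Z₁) (h12 : Z₁ ≤ Z₂) :
    α * Z₁ ^ 2 - β * Z₁ + γ ≤ α * Z₂ ^ 2 - β * Z₂ + γ := by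
  have h : α * Z₂ ^ 2 - β * Z₂ + γ - (α * Z₁ ^ 2 - β * Z₁ + γ) = (Z₂ - Z₁) * (α * (Z₂ + Z₁) - β) := by ring
  have h1 : 0 ≤ Z₂ - Z₁ := by linarith
  have h2 : 0 ≤ α * (Z₂ + Z₁) - β := by nlinarith
  nlinarith [mul_nonneg h1 h2]

/-- ★ **LINEAR COUNT BEYOND THE EXACT BALANCE ZONE** (no-dip company, bottom coupling, ANY support): if `U > 0` is past every row's vertex,
`q(q−3p)·a_{j1}a_{j2} ≤ 2pq·a_{j2}²·U^{d₂−d₁}`, and every balance form is non-negative at `U`,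
`pq·a_{j2}²·U^{2(d₂−d₁)} − q(q−3p)·a_{j1}a_{j2}·U^{d₂−d₁} + p²·a_{j1}² ≥ 0`, then `eulerNumerator d a 0` has at most `2m + 1` roots in `[U,∞)`.
[this file's theorem] -/
theorem euler_roots_beyond_exactZone_le {m : ℕ} (d : Fin 3 → ℕ) (h01 : d 0 < d 1) (h12 : d 1 < d 2)
    (a : Fin m → Fin 3 → ℝ) (hac : ∀ j, a j 0 * a j 2 < 0) {U : ℝ} (hU : 0 < U)
    (hvert : ∀ j, ((d 2 : ℝ) - d 0) * (((d 2 : ℝ) - d 0) - 3 * ((d 1 : ℝ) - d 0)) * (a j 1 * a j 2)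
      ≤ 2 * (((d 1 : ℝ) - d 0) * ((d 2 : ℝ) - d 0) * a j 2 ^ 2) * U ^ (d 2 - d 1))
    (hbal : ∀ j, 0 ≤ ((d 1 : ℝ) - d 0) * ((d 2 : ℝ) - d 0) * a j 2 ^ 2 * (U ^ (d 2 - d 1)) ^ 2
        - ((d 2 : ℝ) - d 0) * (((d 2 : ℝ) - d 0) - 3 * ((d 1 : ℝ) - d 0)) * (a j 1 * a j 2) * U ^ (d 2 - d 1)
        + ((d 1 : ℝ) - d 0) ^ 2 * a j 1 ^ 2) :
    ((∑ j, (∑ l, C (a j l * ((d l : ℝ) - d 0)) * X ^ (d l)) * ∏ i ∈ Finset.univ.erase j, (∑ l, C (a i l) * X ^ (d l))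
        : ℝ[X]).roots.toFinset.filter (fun t => U ≤ t)).card ≤ 2 * m + 1 := by
  classical
  rcases Nat.eq_zero_or_pos m with hm | hm
  · subst hm
    simp only [Finset.univ_eq_empty, Finset.sum_empty, roots_zero, Multiset.toFinset_zero, Finset.filter_empty,
      Finset.card_empty]
    exact Nat.zero_le _
  obtain ⟨e, he⟩ : ∃ e, d 1 = d 0 + e + 1 := ⟨d 1 - d 0 - 1, by omega⟩
  obtain ⟨k, hk⟩ : ∃ k, d 2 = d 0 + e + k + 2 := ⟨d 2 - d 1 - 1, by omega⟩
  have hk1 : d 2 - d 1 = k + 1 := by omega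
  have hp : ((d 1 : ℝ) - d 0) = (e + 1 : ℝ) := by rw [he]; push_cast; ring
  have hq : ((d 2 : ℝ) - d 0) = (e + k + 2 : ℝ) := by rw [hk]; push_cast; ring
  rw [eulerNumerator_eq d e k he hk a 0, sub_self, mul_zero, map_zero, zero_mul, sub_zero]
  set P : ℝ[X] := ∏ j, (C (a j 0) + C (a j 1) * X ^ (e + 1) + C (a j 2) * X ^ (e + k + 2)) with hPdef
  have hac' : ∀ j, a j 0 * a j 2 < 0 := hac
  have hP0 : P ≠ 0 := prod_trinomial_ne_zero (fun j => a j 0) (fun j => a j 1) (fun j => a j 2) e k hac'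
  refine (card_roots_X_pow_mul_filter_le (m * d 0) (X * derivative P) (fun t => U ≤ t) (fun t ht => (hU.trans_le ht).ne')).trans ?_
  have hZ : (P.roots.toFinset.filter (fun t => U ≤ t)).card ≤ m := by
    refine le_trans (card_le_card fun t ht => ?_)
      (prod_trinomial_pos_roots_le (fun j => a j 0) (fun j => a j 1) (fun j => a j 2) e k hac')
    rw [mem_filter] at ht ⊢
    exact ⟨ht.1, hU.trans_le ht.2⟩
  -- the balance form at `t ≥ U` is at least the balance form at `U`
  have hBt : ∀ t : ℝ, U ≤ t → ∀ j, 0 ≤ (e + 1 : ℝ) * (e + k + 2 : ℝ) * a j 2 ^ 2 * (t ^ (k + 1)) ^ 2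
      - (e + k + 2 : ℝ) * ((e + k + 2 : ℝ) - 3 * (e + 1 : ℝ)) * (a j 1 * a j 2) * t ^ (k + 1) + (e + 1 : ℝ) ^ 2 * a j 1 ^ 2 := by
    intro t hUt j
    have h0 := hbal j
    have hv := hvert j
    rw [hp, hq, hk1] at h0 hv
    have hZZ : U ^ (k + 1) ≤ t ^ (k + 1) := pow_le_pow_left₀ hU.le hUt _
    have hmono := balance_mono_beyond_vertex ((e + 1 : ℝ) * (e + k + 2 : ℝ) * a j 2 ^ 2)
      ((e + k + 2 : ℝ) * ((e + k + 2 : ℝ) - 3 * (e + 1 : ℝ)) * (a j 1 * a j 2)) ((e + 1 : ℝ) ^ 2 * a j 1 ^ 2)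
      (by positivity) hv hZZ
    linarith
  have h := roots_filter_le_of_windowLaw P (X * derivative P) hP0 (fun t => U ≤ t)
    (fun z₁ _ t h₁ _ h₂ _ => h₁.trans h₂) m hZ (fun w₁ w₂ hw₁ _ hw hfree h1 h2 => ?_)
  · exact h.trans (by omega)
  · have hfree' : ∀ t ∈ Set.Icc w₁ w₂, ∀ j, a j 0 + a j 1 * t ^ (e + 1) + a j 2 * t ^ (e + k + 2) ≠ 0 := by
      intro t ht j hj
      apply hfree t ht
      rw [hPdef, eval_prod_trinomial, Finset.prod_eq_zero_iff]
      exact ⟨j, mem_univ _, hj⟩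
    exact X_mul_derivative_no_two_zeros_of_rows'' hm (fun j => a j 0) (fun j => a j 1) (fun j => a j 2) e k
      (hU.trans_le hw₁) hw hfree' (fun t ht j => Or.inr ⟨hac' j, hBt t (hw₁.trans ht.1) j⟩) h1 h2

end ProductPlusOne

end Summit.ValiantsHypothesis.ValiantsHypothesis.Theorems.LacunarySymmetroidMatrixDescartes
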